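import Summits.Ventures.PackingBounds.Energy.FivePointRieszSix
import Summits.Ventures.PackingBounds.Energy.ThreePointEnergyDeficit
import Summits.Ventures.PackingBounds.Energy.FivePointBipyramidRigidity
import HarnessLib

/-!
# Five points on `S²`, Riesz 6-energy: every minimiser is a triangular bipyramid (rigidity)

Framing: lottery ticket; floor = certified bounds/negative ranges. Venture `PackingBounds`, cell
`pub-packcert`, energy family E3PT (pub-packcert-energy gen 15; n = 3, d = 8 kernel route = KERNEL-D6 double data route, size-split).

Complementary slackness for the kernel-checked sharp d = 8 certificate `FivePointRieszSix.riesz_six_five_points`: if five unit vectors `C ⊂ ℝ³` attain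
`Σ_{x≠y} 1/(‖x-y‖²)^3 = 505/288`, then every inner product of distinct points lies in `{-1, 0, -1/2}` (equality in the Hermite
minorant `p ≤ 1/(2-2t)^3`, `1-(2-2t)^3p(t) = (1+t)(1+2t)²t²·q(t)` with `q > 0` on `[-1,1]`), `Σ x = 0` (two-point multiplier `a₁ > 0`,
`ThreePointDeficit`), hence `C` is a triangular bipyramid (`Bipyramid5.rigid`).
-/

noncomputable section

open Finset
open scoped RealInnerProductSpace

namespace Summit.Ventures.PackingBounds.Energy.FivePointRieszSix

open Literature.Geometry.DiscreteGeometry Literature.Geometry.DiscreteGeometry.BachocVallentin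
open Literature.Analysis.SpecialFunctions

/-- The Hermite cofactor `q` is positive on `[-1,1]` (positive Bernstein coefficients). -/
theorem qaux_posR6 (t : ℝ) (h1 : -1 ≤ t) (h2 : t ≤ 1) : 0 < qauxR6 t := by
  unfold qauxR6
  have ha : 0 ≤ 1 - t := by linarith
  have hb : 0 ≤ 1 + t := by linarith
  nlinarith [mul_nonneg ha hb, mul_nonneg ha ha, mul_nonneg hb hb, sq_nonneg t, mul_nonneg (mul_nonneg ha hb) ha, mul_nonneg (mul_nonneg ha hb) hb]

/-- Equality in the Hermite minorant `p(t) ≤ 1/(2-2t)^3` on `[-1,1)` forces `t ∈ {-1, 0, -1/2}`. -/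
theorem inner_of_pmin_eqR6 (t : ℝ) (h1 : -1 ≤ t) (h2 : t < 1) (heq : pminKR6 t = 1 / (2 - 2 * t) ^ 3) :
    t = -1 ∨ t = 0 ∨ t = -1 / 2 := by
  have hpos : 0 < (2 - 2 * t) ^ 3 := pow_pos (by linarith) 3
  have hm : (2 - 2 * t) ^ 3 * pminKR6 t = 1 := by rw [heq, mul_one_div, div_self hpos.ne']
  have hid := one_sub_mul_pminR6 t
  have hq := qaux_posR6 t h1 h2.le
  have hz0 : (1 + t) * (1 + 2 * t) ^ 2 * t ^ 2 * qauxR6 t = 0 := by linarith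
  have hz : (1 + t) * (1 + 2 * t) ^ 2 * t ^ 2 = 0 := by
    rcases mul_eq_zero.1 hz0 with h | h
    · exact h
    · exact absurd h hq.ne'
  rcases mul_eq_zero.1 hz with h | h
  · rcases mul_eq_zero.1 h with h' | h'
    · left; linarith
    · right; right
      have := (pow_eq_zero_iff two_ne_zero).1 h'
      linarith
  · right; left; exact (pow_eq_zero_iff two_ne_zero).1 h

/-- **Rigidity of the Riesz 6-energy ground state of five points.** If five unit vectors of `ℝ³`
attain `Σ_{x≠y} 1/(‖x-y‖²)^3 = 505/288`, then all inner products of distinct points lie in `{-1, 0, -1/2}`,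
`Σ x = 0`, and the configuration is a triangular bipyramid. -/
theorem riesz_six_five_points_rigid (C : Finset (EuclideanSpace ℝ (Fin 3))) (hC : ∀ x ∈ C, ‖x‖ = 1)
    (h5 : C.card = 5)
    (hmin : ∑ x ∈ C, ∑ y ∈ C.erase x, 1 / (‖x - y‖ ^ 2) ^ 3 = ((505 : ℝ)/288)) :
    (∀ x ∈ C, ∀ y ∈ C, x ≠ y → inner ℝ x y = -1 ∨ inner ℝ x y = 0 ∨ inner ℝ x y = -1 / 2)
    ∧ (∑ x ∈ C, x = 0)
    ∧ ∃ p ∈ C, -p ∈ C ∧ (∀ z ∈ C, z ≠ p → z ≠ -p → inner ℝ z p = 0)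
        ∧ (∀ z ∈ C, ∀ w ∈ C, z ≠ p → z ≠ -p → w ≠ p → w ≠ -p → z ≠ w → inner ℝ z w = -1 / 2) := by
  classical
  have hA := pairSum_gegenbauer_comb_nonneg (n := 3) (by norm_num) 1 acoKR6 aco_nonnegR6 C hC
  have hF := tripleSum_threePointF3_nonneg 8 8 dcoKR6 dco_nonnegR6 gwKR6 C hC
  have hcard : (C.card : ℝ) = 5 := by exact_mod_cast h5
  have hAeval : ∀ w : ℝ, (∑ k ∈ range (1 + 1), acoKR6 k * gegenbauerSum ((((3 : ℕ) : ℝ) - 2) / 2) k w)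
      = a1KR6 * w := by
    intro w
    have h0 : acoKR6 0 = 0 := rfl
    have h1 : acoKR6 1 = a1KR6 := rfl
    simp only [Finset.sum_range_succ, Finset.sum_range_zero, h0, h1, gegenbauerSum_one, gegenbauerSum_zero]
    push_cast
    ring
  have hineq : ∀ u v t : ℝ, -1 ≤ u → u < 1 → -1 ≤ v → v < 1 → -1 ≤ t → t < 1 →
      0 ≤ 1 + 2 * u * v * t - u ^ 2 - v ^ 2 - t ^ 2 →
      c0KR6 + ((C.card : ℝ) - 2) * threePointF3 8 8 dcoKR6 gwKR6 u v t + threePointF3 8 8 dcoKR6 gwKR6 u u 1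
        + threePointF3 8 8 dcoKR6 gwKR6 v v 1 + threePointF3 8 8 dcoKR6 gwKR6 t t 1
        + ((fun w => ∑ k ∈ range (1 + 1), acoKR6 k * gegenbauerSum ((((3 : ℕ) : ℝ) - 2) / 2) k w) u
          + (fun w => ∑ k ∈ range (1 + 1), acoKR6 k * gegenbauerSum ((((3 : ℕ) : ℝ) - 2) / 2) k w) v
          + (fun w => ∑ k ∈ range (1 + 1), acoKR6 k * gegenbauerSum ((((3 : ℕ) : ℝ) - 2) / 2) k w) t) / 3
        ≤ (pminKR6 u + pminKR6 v + pminKR6 t) / 3 := by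
    intro u v t hu1 hu2 hv1 hv2 ht1 ht2 hdet
    simp only [hAeval, hcard, threePointF3_eqR6]
    have h1 := slack_nonnegR6 u v t
    linarith
  have key := CohnWoo.energy_ge_of_threePoint C hC (by omega) pminKR6 _ _ c0KR6 hA hF
    (threePointF3_swap12 8 8 dcoKR6 gwKR6) (threePointF3_swap23 8 8 dcoKR6 gwKR6) hineq
  have key' := key
  simp only [hAeval, hcard, threePointF3_eqR6] at key'
  have hb : (5 : ℝ) * ((5 - 1) * c0KR6 - FexpKR6 1 1 1 - a1KR6 * 1) = ((505 : ℝ)/288) := by rw [bound_eqR6]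
  rw [hb] at key'
  have hle : ∀ x ∈ C, ∀ y ∈ C.erase x, pminKR6 (inner ℝ x y) ≤ 1 / (‖x - y‖ ^ 2) ^ 3 := by
    intro x hx y hy
    have hyC : y ∈ C := Finset.mem_of_mem_erase hy
    have hxy : x ≠ y := fun h => (Finset.ne_of_mem_erase hy) h.symm
    have hlo : -1 ≤ inner ℝ x y := neg_one_le_real_inner_of_norm_eq_one (hC x hx) (hC y hyC)
    have hne : inner ℝ x y ≠ 1 := fun h1 =>
      hxy ((inner_eq_one_iff_of_norm_eq_one (𝕜 := ℝ) (hC x hx) (hC y hyC)).1 h1)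
    have hhi : inner ℝ x y < 1 := lt_of_le_of_ne (real_inner_le_one_of_norm_eq_one (hC x hx) (hC y hyC)) hne
    have hnorm : ‖x - y‖ ^ 2 = 2 - 2 * inner ℝ x y := by
      rw [@norm_sub_sq_real, hC x hx, hC y hyC]; ring
    rw [hnorm]
    exact pmin_leR6 _ hlo hhi
  have hsumle : ∑ x ∈ C, ∑ y ∈ C.erase x, pminKR6 (inner ℝ x y) ≤ ∑ x ∈ C, ∑ y ∈ C.erase x, 1 / (‖x - y‖ ^ 2) ^ 3 :=
    Finset.sum_le_sum fun x hx => Finset.sum_le_sum fun y hy => hle x hx y hy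
  have hEqP : ∑ x ∈ C, ∑ y ∈ C.erase x, pminKR6 (inner ℝ x y) = ((505 : ℝ)/288) := by
    apply le_antisymm _ key'
    rw [← hmin]; exact hsumle
  have hEq2 : ∑ x ∈ C, ∑ y ∈ C.erase x, pminKR6 (inner ℝ x y) = ∑ x ∈ C, ∑ y ∈ C.erase x, 1 / (‖x - y‖ ^ 2) ^ 3 := by
    rw [hEqP, hmin]
  have hterm : ∀ x ∈ C, ∀ y ∈ C.erase x, pminKR6 (inner ℝ x y) = 1 / (‖x - y‖ ^ 2) ^ 3 := by
    have houter := (Finset.sum_eq_sum_iff_of_le (fun x hx => Finset.sum_le_sum fun y hy => hle x hx y hy)).1 hEq2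
    intro x hx
    exact (Finset.sum_eq_sum_iff_of_le (fun y hy => hle x hx y hy)).1 (houter x hx)
  have hvals : ∀ x ∈ C, ∀ y ∈ C, x ≠ y → inner ℝ x y = -1 ∨ inner ℝ x y = 0 ∨ inner ℝ x y = -1 / 2 := by
    intro x hx y hy hxy
    have hy' : y ∈ C.erase x := Finset.mem_erase.2 ⟨fun h => hxy h.symm, hy⟩
    have hlo : -1 ≤ inner ℝ x y := neg_one_le_real_inner_of_norm_eq_one (hC x hx) (hC y hy)
    have hne : inner ℝ x y ≠ 1 := fun h1 =>
      hxy ((inner_eq_one_iff_of_norm_eq_one (𝕜 := ℝ) (hC x hx) (hC y hy)).1 h1)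
    have hhi : inner ℝ x y < 1 := lt_of_le_of_ne (real_inner_le_one_of_norm_eq_one (hC x hx) (hC y hy)) hne
    have hnorm : ‖x - y‖ ^ 2 = 2 - 2 * inner ℝ x y := by
      rw [@norm_sub_sq_real, hC x hx, hC y hy]; ring
    have h := hterm x hx y hy'
    rw [hnorm] at h
    exact inner_of_pmin_eqR6 _ hlo hhi h
  have hsharp : ∑ x ∈ C, ∑ y ∈ C.erase x, pminKR6 (inner ℝ x y)
      = (C.card : ℝ) * (((C.card : ℝ) - 1) * c0KR6 - threePointF3 8 8 dcoKR6 gwKR6 1 1 1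
        - (fun w => ∑ k ∈ range (1 + 1), acoKR6 k * gegenbauerSum ((((3 : ℕ) : ℝ) - 2) / 2) k w) 1) := by
    simp only [hAeval, hcard, threePointF3_eqR6]
    rw [hEqP, ← hb]
  obtain ⟨hA0, -⟩ := ThreePointDeficit.pairSum_eq_zero_of_sharp C hC (by omega) pminKR6 _ _ c0KR6 hA hF
    (threePointF3_swap12 8 8 dcoKR6 gwKR6) (threePointF3_swap23 8 8 dcoKR6 gwKR6) hineq hsharp
  have hfun : (fun w => ∑ k ∈ range (1 + 1), acoKR6 k * gegenbauerSum ((((3 : ℕ) : ℝ) - 2) / 2) k w)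
      = fun t => a1KR6 * t := funext hAeval
  rw [hfun] at hA0
  have hsum0 : ∑ x ∈ C, x = 0 := ThreePointDeficit.sum_eq_zero_of_sharp C a1KR6 a1_posR6 hA0
  exact ⟨hvals, hsum0, Bipyramid5.rigid C hC h5 hsum0 hvals⟩

end Summit.Ventures.PackingBounds.Energy.FivePointRieszSix
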